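import Mathlib
import Summits.ValiantsHypothesis.ValiantsHypothesis.Theorems.BarrierLeverDefinableEquationsProductDepthWallUniversal

/-!
# Route BarrierLever — crux `DefinableEquations` (stmt-8745) / item `SingleSizeEquations`
# (stmt-8749): the GENERIC AFFINE ABP PRINCIPLE — one small circuit that maximises EVERY
# coordinate-matrix rank over all width-`n`, length-`n` affine branching programs (val-np-p5 g10)

All natural proofs on the model axis and all method walls of val-np-p5 g3–g10 are COORDINATE RANK
METHODS: a shape `T : Fin r × Fin r → (monomials of degree ≤ n)` and the matrix
`M_T(f) = (coeff_{T(i,j)} f)_{i,j}` (`RankTemplate`, `BlockPlacement`).  The wall witnesses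
`(Σx_i²)^{⌊n/2⌋}` (partial derivatives), `∏(1 + x_ρ x_κ)` (Nisan), `hardPoly` (Kalorkoti) and the
placed word polynomials `e_*(P_w)` (LST) are all computed by algebraic branching programs of width
`≤ n` and length `≤ n` with affine edge labels, i.e. they are SPECIALISATIONS
`F_A = tr(L^{(1)}_A(x) ⋯ L^{(n)}_A(x))` of the generic affine `IMM_{n,n}` of
`…ProductDepthWallUniversal.lean`.  The specialisation trick used there for LST is completely general:

**Theorem (`exists_generic_maximiser`).**  For every `n` and every size bound `R` there is ONE
coefficient tensor `A⋆` such that for EVERY shape `T` of size `r ≤ R` and EVERY tensor `A`,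
`rank M_T(F_A) ≤ rank M_T(F_{A⋆})` — the single polynomial `F_{A⋆}` (degree `≤ n`, complexity
`≤ n + 2n⁴ + n³(2n+1)`, so in `SmallCircuits ℂ n 5` for `n ≥ 5`: `exists_generic_maximiser_smallCircuits`)
simultaneously attains, for every coordinate rank measure of size `≤ R`, the maximum of that measure
over the whole class of width-`n` length-`n` affine ABPs.  Proof: for each of the finitely many
shapes pick a tensor attaining the maximal rank `m_T` (`Nat.findGreatest`) and a nonzero
`m_T`-minor there; that minor of the generic matrix is a nonzero polynomial in `A`; avoid the
product of all of them (`MvPolynomial.funext`).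

Consequence (`rankMethod_useless_of_abp_witness`): a coordinate rank method whose LARGENESS
witness `g` is itself such an ABP (`g = F_A` for some `A`, as in all four walls) proves nothing
against `SmallCircuits ℂ n 5`: the class condition `rank M_T < rank M_T(g)` fails at `F_{A⋆}`.
What this is NOT: no claim for witnesses outside the affine-ABP class (e.g. the Raz–Yehudayoff
full-rank polynomial, handled separately in `…FullRankMethodWall.lean`), nothing on the crux
(b = 2 OPEN) or `VP ≠ VNP`.  No definitions, no named facts, standard axioms.
Refs: Raz–Yehudayoff 2008 §4 (specialisation); Forbes–Shpilka–Volk 2018 Def. 1/3 and §1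
(rank methods as succinct matrices).
-/

-- `Summit.ValiantsHypothesis.ValiantsHypothesis.…` repeats a component by the D-0017 layout
-- (single-conjunct summit), which the `dupNamespace` linter flags; the name is mandated.
set_option linter.dupNamespace false

noncomputable section

namespace Summit.ValiantsHypothesis.ValiantsHypothesis.Theorems.BarrierLeverDefinableEquations

open MvPolynomial
open Literature.Computability.AlgebraicComplexity
open Literature.Barriers.ValiantsHypothesis
open scoped BigOperators

namespace GenericAffineABP

open ProductDepthWallUniversal

/-- **The generic affine ABP principle.**  For every `n` and `R` there is a coefficient tensor
`A⋆` such that for every shape `T : Fin r → Fin r → (Fin n →₀ ℕ)` with `r ≤ R` and every tensor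
`A`, the coordinate matrix `(coeff_{T i j} F_A)` has rank at most that of `(coeff_{T i j} F_{A⋆})`,
where `F_A` is `IMM_{n,n}` composed with the affine forms of coefficient tensor `A`.
[cite: RazYehudayoff2008, §4 (specialisation argument)] -/
theorem exists_generic_maximiser (n R : ℕ) :
    ∃ Astar : (Fin n × Fin n × Fin n) × Option (Fin n) → ℂ,
      ∀ (r : ℕ), r ≤ R → ∀ (T : Fin r → Fin r → ↥(degLEMonomials n))
        (A : (Fin n × Fin n × Fin n) × Option (Fin n) → ℂ),
        (Matrix.of fun i j => coeff ((T i j : ↥(degLEMonomials n)) : Fin n →₀ ℕ)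
          (aeval (fun v : Fin n × Fin n × Fin n =>
            ((∑ u : Fin n, C (A (v, some u)) * X u + C (A (v, none))) : MvPolynomial (Fin n) ℂ))
            (immPoly n n ℂ))).rank ≤
        (Matrix.of fun i j => coeff ((T i j : ↥(degLEMonomials n)) : Fin n →₀ ℕ)
          (aeval (fun v : Fin n × Fin n × Fin n =>
            ((∑ u : Fin n, C (Astar (v, some u)) * X u + C (Astar (v, none))) :
              MvPolynomial (Fin n) ℂ))
            (immPoly n n ℂ))).rank := by
  classical
  haveI : Fintype (degLEMonomials n) := (Finsupp.finite_of_degree_le (σ := Fin n) n).fintype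
  -- the generic polynomial and its specialisations
  obtain ⟨G, hG⟩ : ∃ G : MvPolynomial (Fin n)
      (MvPolynomial ((Fin n × Fin n × Fin n) × Option (Fin n)) ℂ),
      G = aeval (fun v : Fin n × Fin n × Fin n =>
        (∑ u : Fin n, C (X (v, some u)) * X u + C (X (v, none)) :
          MvPolynomial (Fin n) (MvPolynomial ((Fin n × Fin n × Fin n) × Option (Fin n)) ℂ)))
        (immPoly n n ℂ) := ⟨_, rfl⟩
  have hspec : ∀ A : (Fin n × Fin n × Fin n) × Option (Fin n) → ℂ,
      MvPolynomial.mapAlgHom (σ := Fin n) (MvPolynomial.aeval A) G =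
        aeval (fun v : Fin n × Fin n × Fin n =>
          (∑ u : Fin n, C (A (v, some u)) * X u + C (A (v, none)) : MvPolynomial (Fin n) ℂ))
          (immPoly n n ℂ) := fun A => by rw [hG]; exact mapAlgHom_aeval_generic A
  -- per shape: a nonzero polynomial in `A` detecting maximal rank
  have key : ∀ (r : Fin (R + 1)) (T : Fin r → Fin r → ↥(degLEMonomials n)),
      ∃ Q : MvPolynomial ((Fin n × Fin n × Fin n) × Option (Fin n)) ℂ, Q ≠ 0 ∧
        ∀ A' : (Fin n × Fin n × Fin n) × Option (Fin n) → ℂ, MvPolynomial.aeval A' Q ≠ 0 →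
          ∀ A : (Fin n × Fin n × Fin n) × Option (Fin n) → ℂ,
            (Matrix.of fun i j => coeff ((T i j : ↥(degLEMonomials n)) : Fin n →₀ ℕ)
              (MvPolynomial.mapAlgHom (σ := Fin n) (MvPolynomial.aeval A) G)).rank ≤
            (Matrix.of fun i j => coeff ((T i j : ↥(degLEMonomials n)) : Fin n →₀ ℕ)
              (MvPolynomial.mapAlgHom (σ := Fin n) (MvPolynomial.aeval A') G)).rank := by
    intro r T
    -- the maximal rank over all specialisations
    set m₀ := Nat.findGreatest (fun m => ∃ A : (Fin n × Fin n × Fin n) × Option (Fin n) → ℂ,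
      m ≤ (Matrix.of fun i j => coeff ((T i j : ↥(degLEMonomials n)) : Fin n →₀ ℕ)
        (MvPolynomial.mapAlgHom (σ := Fin n) (MvPolynomial.aeval A) G)).rank) r with hm₀
    have hle : ∀ A : (Fin n × Fin n × Fin n) × Option (Fin n) → ℂ,
        (Matrix.of fun i j => coeff ((T i j : ↥(degLEMonomials n)) : Fin n →₀ ℕ)
          (MvPolynomial.mapAlgHom (σ := Fin n) (MvPolynomial.aeval A) G)).rank ≤ m₀ := by
      intro A
      refine Nat.le_findGreatest ?_ ⟨A, le_rfl⟩
      simpa [Fintype.card_fin] using Matrix.rank_le_card_height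
        (Matrix.of fun i j => coeff ((T i j : ↥(degLEMonomials n)) : Fin n →₀ ℕ)
          (MvPolynomial.mapAlgHom (σ := Fin n) (MvPolynomial.aeval A) G))
    by_cases hz : m₀ = 0
    · refine ⟨1, one_ne_zero, fun A' _ A => ?_⟩
      rw [hz] at hle
      exact (hle A).trans (Nat.zero_le _)
    · obtain ⟨A₀, hA₀⟩ : ∃ A : (Fin n × Fin n × Fin n) × Option (Fin n) → ℂ,
          m₀ ≤ (Matrix.of fun i j => coeff ((T i j : ↥(degLEMonomials n)) : Fin n →₀ ℕ)
            (MvPolynomial.mapAlgHom (σ := Fin n) (MvPolynomial.aeval A) G)).rank :=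
        Nat.findGreatest_of_ne_zero hm₀.symm hz
      obtain ⟨ρ, κ, -, -, hdet⟩ :=
        Literature.LinearAlgebra.Matrix.exists_det_submatrix_ne_zero_of_le_rank _ hA₀
      refine ⟨((Matrix.of fun i j => coeff ((T i j : ↥(degLEMonomials n)) : Fin n →₀ ℕ) G).submatrix
        ρ κ).det, ?_, ?_⟩
      · intro hQ
        apply hdet
        have hev := congrArg (MvPolynomial.aeval A₀) hQ
        rw [map_zero, AlgHom.map_det] at hev
        rw [← hev]
        congr 1
      · intro A' hA' A
        refine (hle A).trans ?_
        have hA'' : ((Matrix.of fun i j => coeff ((T i j : ↥(degLEMonomials n)) : Fin n →₀ ℕ)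
            (MvPolynomial.mapAlgHom (σ := Fin n) (MvPolynomial.aeval A') G)).submatrix ρ κ).det
            ≠ 0 := by
          intro h0
          apply hA'
          rw [AlgHom.map_det, ← h0]
          congr 1
        simpa [Fintype.card_fin] using
          Literature.LinearAlgebra.Matrix.card_le_rank_of_det_submatrix_ne_zero _ ρ κ hA''
  choose Q hQ0 hQ using key
  have hprod : (∏ w : (Σ r : Fin (R + 1), (Fin r → Fin r → ↥(degLEMonomials n))), Q w.1 w.2) ≠ 0 :=
    Finset.prod_ne_zero_iff.2 fun w _ => hQ0 _ _
  obtain ⟨Astar, hA⟩ : ∃ A : (Fin n × Fin n × Fin n) × Option (Fin n) → ℂ,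
      MvPolynomial.aeval A (∏ w : (Σ r : Fin (R + 1), (Fin r → Fin r → ↥(degLEMonomials n))),
        Q w.1 w.2) ≠ 0 := by
    by_contra h
    simp only [not_exists, not_not] at h
    exact hprod (MvPolynomial.funext fun A => by rw [map_zero, ← coe_aeval_eq_eval]; exact h A)
  rw [map_prod] at hA
  refine ⟨Astar, fun r hr T A => ?_⟩
  have hw := Finset.prod_ne_zero_iff.1 hA ⟨⟨r, by omega⟩, T⟩ (Finset.mem_univ _)
  have := hQ ⟨r, by omega⟩ T Astar hw A
  rwa [hspec A, hspec Astar] at this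

/-- **The generic maximiser is a small circuit**: for `n ≥ 5` the polynomial `F_{A⋆}` of
`exists_generic_maximiser` may be taken in `SmallCircuits ℂ n 5`, and then for every shape `T` of
size `≤ R` and every width-`n` length-`n` affine ABP `F_A`, `rank M_T(F_A) ≤ rank M_T(f)`.
[cite: ForbesShpilkaVolk2018, Cor. 5] -/
theorem exists_generic_maximiser_smallCircuits {n : ℕ} (h5 : 5 ≤ n) (R : ℕ) :
    ∃ f ∈ SmallCircuits ℂ n 5,
      ∀ (r : ℕ), r ≤ R → ∀ (T : Fin r → Fin r → ↥(degLEMonomials n))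
        (A : (Fin n × Fin n × Fin n) × Option (Fin n) → ℂ),
        (Matrix.of fun i j => coeff ((T i j : ↥(degLEMonomials n)) : Fin n →₀ ℕ)
          (aeval (fun v : Fin n × Fin n × Fin n =>
            ((∑ u : Fin n, C (A (v, some u)) * X u + C (A (v, none))) : MvPolynomial (Fin n) ℂ))
            (immPoly n n ℂ))).rank ≤
        (Matrix.of fun i j => coeff ((T i j : ↥(degLEMonomials n)) : Fin n →₀ ℕ) f).rank := by
  obtain ⟨Astar, hA⟩ := exists_generic_maximiser n R
  refine ⟨aeval (fun v : Fin n × Fin n × Fin n =>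
      ((∑ u : Fin n, C (Astar (v, some u)) * X u + C (Astar (v, none))) : MvPolynomial (Fin n) ℂ))
      (immPoly n n ℂ), ⟨?_, ?_⟩, fun r hr T A => hA r hr T A⟩
  · have hdeg1 : ∀ v : Fin n × Fin n × Fin n,
        ((∑ u : Fin n, C (Astar (v, some u)) * X u + C (Astar (v, none))) :
          MvPolynomial (Fin n) ℂ).totalDegree ≤ 1 :=
      fun v => totalDegree_affine_le (K := ℂ) (fun o => Astar (v, o))
    exact (HasDetRepr.totalDegree_aeval_le_of_le_one (k := ℂ)
      (fun v : Fin n × Fin n × Fin n =>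
        ((∑ u : Fin n, C (Astar (v, some u)) * X u + C (Astar (v, none))) : MvPolynomial (Fin n) ℂ))
      hdeg1 (immPoly n n ℂ)).trans (immPoly_isHomogeneous_holds (k := ℂ) n n).totalDegree_le
  · have hsum : ∑ v : Fin n × Fin n × Fin n, complexity
        (((∑ u : Fin n, C (Astar (v, some u)) * X u + C (Astar (v, none))) : MvPolynomial (Fin n) ℂ))
        ≤ n ^ 3 * (2 * n + 1) := by
      calc ∑ v : Fin n × Fin n × Fin n, complexity
            (((∑ u : Fin n, C (Astar (v, some u)) * X u + C (Astar (v, none))) :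
              MvPolynomial (Fin n) ℂ))
          ≤ ∑ _v : Fin n × Fin n × Fin n, (2 * n + 1) :=
            Finset.sum_le_sum fun v _ => complexity_affine_le fun o => Astar (v, o)
        _ = n ^ 3 * (2 * n + 1) := by
            rw [Finset.sum_const, Finset.card_univ, smul_eq_mul, Fintype.card_prod,
              Fintype.card_prod, Fintype.card_fin]
            ring
    refine ((complexity_aeval_le _ _).trans (Nat.add_le_add (complexity_immPoly_le ℂ n n) hsum)).trans
      ?_
    · have h1 : 2 * n ^ 3 ≤ n ^ 4 := by
        calc 2 * n ^ 3 ≤ n * n ^ 3 := Nat.mul_le_mul_right _ (by omega)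
          _ = n ^ 4 := by ring
      have h2 : n ≤ n ^ 3 := by
        calc n = n ^ 1 := (pow_one n).symm
          _ ≤ n ^ 3 := Nat.pow_le_pow_right (by omega) (by omega)
      have h3 : 5 * n ^ 4 ≤ n ^ 5 := by
        calc 5 * n ^ 4 ≤ n * n ^ 4 := Nat.mul_le_mul_right _ h5
          _ = n ^ 5 := by ring
      have h4 : n + 2 * n ^ 3 * n + n ^ 3 * (2 * n + 1) = n + 4 * n ^ 4 + n ^ 3 := by ring
      rw [h4]
      linarith

/-- **Rank methods with an ABP witness are useless against `SmallCircuits ℂ n 5`.**  If a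
coordinate rank method (shape `T`, threshold `s`) has its largeness witnessed by a width-`n`
length-`n` affine ABP `F_A` — `s ≤ rank M_T(F_A)` — then its class condition
"`rank M_T(f) < s` for all `f ∈ SmallCircuits ℂ n 5`" fails (`n ≥ 5`).  This is the common form of
the partial-derivative, Nisan, Kalorkoti and LST walls (their witnesses are such ABPs).
[cite: ForbesShpilkaVolk2018, Def. 1 and §1] -/
theorem rankMethod_useless_of_abp_witness {n : ℕ} (h5 : 5 ≤ n) {r : ℕ}
    (T : Fin r → Fin r → ↥(degLEMonomials n)) (A : (Fin n × Fin n × Fin n) × Option (Fin n) → ℂ)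
    (s : ℕ) (hs : s ≤ (Matrix.of fun i j => coeff ((T i j : ↥(degLEMonomials n)) : Fin n →₀ ℕ)
          (aeval (fun v : Fin n × Fin n × Fin n =>
            ((∑ u : Fin n, C (A (v, some u)) * X u + C (A (v, none))) : MvPolynomial (Fin n) ℂ))
            (immPoly n n ℂ))).rank) :
    ¬ ∀ f ∈ SmallCircuits ℂ n 5,
      (Matrix.of fun i j => coeff ((T i j : ↥(degLEMonomials n)) : Fin n →₀ ℕ) f).rank < s := by
  intro h
  obtain ⟨f, hf, hmax⟩ := exists_generic_maximiser_smallCircuits h5 r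
  exact absurd ((hs.trans (hmax r le_rfl T A)).trans_lt (h f hf)) (lt_irrefl _)

/-- **What survives (appended, val-np-p5 g10).**  Contrapositive reading for future rank-method
attempts on the crux: if a coordinate rank method (shape `T`, threshold `s`) IS useful against
`SmallCircuits ℂ n 5` (`n ≥ 5`) — every member has `rank M_T < s` — then NO width-`n` length-`n`
affine ABP reaches rank `s`: any largeness witness `g` of the method (`s ≤ rank M_T(g)`) lies
OUTSIDE the affine ABP class `{F_A}`, i.e. the method's witness carries an algebraic-branching-program
lower bound of its own. [cite: ForbesShpilkaVolk2018, Def. 1 and §1] -/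
theorem witness_not_affineABP_of_useful {n : ℕ} (h5 : 5 ≤ n) {r : ℕ}
    (T : Fin r → Fin r → ↥(degLEMonomials n)) (s : ℕ)
    (huse : ∀ f ∈ SmallCircuits ℂ n 5,
      (Matrix.of fun i j => coeff ((T i j : ↥(degLEMonomials n)) : Fin n →₀ ℕ) f).rank < s)
    (g : MvPolynomial (Fin n) ℂ)
    (hg : s ≤ (Matrix.of fun i j => coeff ((T i j : ↥(degLEMonomials n)) : Fin n →₀ ℕ) g).rank) :
    ∀ A : (Fin n × Fin n × Fin n) × Option (Fin n) → ℂ,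
      g ≠ aeval (fun v : Fin n × Fin n × Fin n =>
        ((∑ u : Fin n, C (A (v, some u)) * X u + C (A (v, none))) : MvPolynomial (Fin n) ℂ))
        (immPoly n n ℂ) := by
  intro A hgA
  rw [hgA] at hg
  exact rankMethod_useless_of_abp_witness h5 T A s hg huse

/-- Equivalently: usefulness against `SmallCircuits ℂ n 5` forces `rank M_T(F_A) < s` for EVERY
width-`n` length-`n` affine ABP `F_A` — the threshold exceeds the whole affine-ABP range of the
measure. [cite: ForbesShpilkaVolk2018, Def. 1] -/
theorem rank_affineABP_lt_of_useful {n : ℕ} (h5 : 5 ≤ n) {r : ℕ}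
    (T : Fin r → Fin r → ↥(degLEMonomials n)) (s : ℕ)
    (huse : ∀ f ∈ SmallCircuits ℂ n 5,
      (Matrix.of fun i j => coeff ((T i j : ↥(degLEMonomials n)) : Fin n →₀ ℕ) f).rank < s)
    (A : (Fin n × Fin n × Fin n) × Option (Fin n) → ℂ) :
    (Matrix.of fun i j => coeff ((T i j : ↥(degLEMonomials n)) : Fin n →₀ ℕ)
      (aeval (fun v : Fin n × Fin n × Fin n =>
        ((∑ u : Fin n, C (A (v, some u)) * X u + C (A (v, none))) : MvPolynomial (Fin n) ℂ))
        (immPoly n n ℂ))).rank < s := by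
  by_contra hge
  exact rankMethod_useless_of_abp_witness h5 T A s (not_lt.1 hge) huse

/-- **UNION rank methods with ABP witnesses are useless against `SmallCircuits ℂ n 5`** — the
genuine content of the simultaneous maximiser (the single-shape statements above already follow
from the membership `F_A ∈ SmallCircuits ℂ n 5`; the union needs ONE member beating a DIFFERENT
witness for every shape).  Let `(T_i, s_i)_{i ∈ ι}` be any family of coordinate shapes of sizes
`r_i ≤ R` with thresholds, each made LARGE by some width-`n` length-`n` affine ABP `F_{A_i}`
(`s_i ≤ rank M_{T_i}(F_{A_i})`).  Then the union class condition "every `f ∈ SmallCircuits ℂ n 5`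
has SOME `i` with `rank M_{T_i}(f) < s_i`" FAILS (`n ≥ 5`): the generic maximiser beats all
witnesses at once.  (Raz's full-rank method is such a union over cuts — but its witness is not an
affine ABP of width `n`, see `…FullRankMethodWall.lean`; the LST union over word data is the
instance `…ProductDepthWallUniversal.lean`.) [cite: ForbesShpilkaVolk2018, Def. 1 and §1] -/
theorem unionRankMethod_useless_of_abp_witnesses {n : ℕ} (h5 : 5 ≤ n) (R : ℕ) {ι : Type*}
    (r : ι → ℕ) (hr : ∀ i, r i ≤ R) (T : (i : ι) → Fin (r i) → Fin (r i) → ↥(degLEMonomials n))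
    (s : ι → ℕ) (A : ι → (Fin n × Fin n × Fin n) × Option (Fin n) → ℂ)
    (hs : ∀ i, s i ≤ (Matrix.of fun a b => coeff ((T i a b : ↥(degLEMonomials n)) : Fin n →₀ ℕ)
      (aeval (fun v : Fin n × Fin n × Fin n =>
        ((∑ u : Fin n, C (A i (v, some u)) * X u + C (A i (v, none))) : MvPolynomial (Fin n) ℂ))
        (immPoly n n ℂ))).rank) :
    ¬ ∀ f ∈ SmallCircuits ℂ n 5, ∃ i : ι,
      (Matrix.of fun a b => coeff ((T i a b : ↥(degLEMonomials n)) : Fin n →₀ ℕ) f).rank < s i := by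
  intro h
  obtain ⟨f, hf, hmax⟩ := exists_generic_maximiser_smallCircuits h5 R
  obtain ⟨i, hi⟩ := h f hf
  exact absurd (((hs i).trans (hmax (r i) (hr i) (T i) (A i))).trans_lt hi) (lt_irrefl _)

/-- FSV form for unions: a polynomial `D` in the coefficient variables whose zero set on
degree-`≤ n` coefficient vectors is a UNION of coordinate-rank-deficiency loci
`⋃_i {rank M_{T_i} < s_i}` (sizes `≤ R`), each threshold attained by a width-`n` length-`n` affine
ABP, is NOT an `IsNaturalProof` against `SmallCircuits ℂ n 5` (`n ≥ 5`), in any distinguisher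
class. [cite: ForbesShpilkaVolk2018, Def. 1] -/
theorem not_isNaturalProof_of_zeroSet_unionRank {n : ℕ} (h5 : 5 ≤ n) (R : ℕ) {ι : Type*}
    (r : ι → ℕ) (hr : ∀ i, r i ≤ R) (T : (i : ι) → Fin (r i) → Fin (r i) → ↥(degLEMonomials n))
    (s : ι → ℕ) (A : ι → (Fin n × Fin n × Fin n) × Option (Fin n) → ℂ)
    (hs : ∀ i, s i ≤ (Matrix.of fun a b => coeff ((T i a b : ↥(degLEMonomials n)) : Fin n →₀ ℕ)
      (aeval (fun v : Fin n × Fin n × Fin n =>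
        ((∑ u : Fin n, C (A i (v, some u)) * X u + C (A i (v, none))) : MvPolynomial (Fin n) ℂ))
        (immPoly n n ℂ))).rank)
    (𝒟 : Set (MvPolynomial (degLEMonomials n) ℂ)) (D : MvPolynomial (degLEMonomials n) ℂ)
    (hD : ∀ g : MvPolynomial (Fin n) ℂ, g.totalDegree ≤ n →
      (eval (coeffVector (degLEMonomials n) g) D = 0 ↔
        ∃ i : ι, (Matrix.of fun a b =>
          coeff ((T i a b : ↥(degLEMonomials n)) : Fin n →₀ ℕ) g).rank < s i)) :
    ¬ IsNaturalProof (degLEMonomials n) (SmallCircuits ℂ n 5) 𝒟 D := by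
  rintro ⟨-, -, hvan⟩
  exact unionRankMethod_useless_of_abp_witnesses h5 R r hr T s A hs
    fun f hf => (hD f hf.1).1 (hvan f hf)

end GenericAffineABP

end Summit.ValiantsHypothesis.ValiantsHypothesis.Theorems.BarrierLeverDefinableEquations
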